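import Mathlib.GroupTheory.Index
import Mathlib.GroupTheory.QuotientGroup.Defs
import Mathlib.Analysis.SpecialFunctions.Pow.Real
import Literature.InformationTheory.QuantumCodes.LocalityBounds
import Literature.InformationTheory.QuantumCodes.AbelianTwoBlockParameters
import Literature.Algebra.EuclideanLattices.SuccessiveMinima
import HarnessLib

/-!
# The Bravyi–Terhal bound on a lattice quotient `ℤ^D/Λ` and the distance of abelian two-block codes
# (Arnault–Gaborit–Rozendaal–Saussay–Zémor 2026) — statements

Topic `Literature/InformationTheory/QuantumCodes` (venture QEC, cell `qec`, PARTITION row 06; LADDER-QEC rung X1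
«barriers: locality bounds»). STATEMENTS FIRST (D-0014): the two published theorems are `[cite:]` NAMED FACTS
`def … : Prop`, never asserted; each carries a BARRIER block so that it doubles as an X1 catalogue entry. They
extend the catalogue of `LocalityBounds.lean` (Bravyi–Terhal 2009 on the cube / torus `{1,…,L}^D`,
Bravyi–Poulin–Terhal 2010) to ARBITRARY periodic boundary conditions `ℤ^D/Λ` — and thereby to the abelian
two-block group-algebra (2BGA) codes, which include the generalized-bicycle and bivariate-bicycle (BB) codes of the
qec census: those codes EVADE `BravyiTerhal2009_*` (their checks are not local on the `ℓ × m` torus) but not this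
bound (every abelian 2BGA code with checks of weight `w` is `1`-local on a quotient `ℤ^{w−2}/Λ`, [ArnaultEtAl2026,
§4 Lemmas 4.2–4.4]). Numerically the hypothesis `n^{1/D} ≥ 8√γ_D` makes the bound void at census sizes (for BB
codes, `w = 6`, `D = 4`: «Theorem 2.18 only applies for `n ≥ 8192`» [PostemaKokkelmans2026, §2 after Thm. 2.19,
arXiv chunk p0014 L24–26]); it is an ASYMPTOTIC catalogue entry (`d = O(n^{3/4})` for weight-6 abelian two-block
codes), with no census consumer at `n ≤ 288`.

Vocabulary (all REUSED; nothing re-declared). Stabilizer codes: the binary symplectic language of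
`SymplecticCodes.lean` (`SympVec N`, `IsAdditiveCode S k d` = «`S̄` self-orthogonal, `dim S̄ + k = N`, no vector of
weight `≤ d − 1` in `S̄⊥ ∖ S̄`» — the MONOTONE reading «minimum distance at least `d`», the faithful and stronger one
for an UPPER bound), `sympSupport` (`LocalityBounds.lean`). The Hermite constant: the tree's
`Literature.Algebra.EuclideanLattices.hermiteConstant D = sup_L λ₁(L)²/covol(L)^{2/D}` over full-rank lattices
`L ⊆ ℝ^D` (`SuccessiveMinima.lean`; `γ_D ≤ D` is PROVED in `SuccessiveMinimaHermiteConstant.lean`, `hermiteConstant_le_self`; `γ₂ = (4/3)^{1/2}`: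
`HermiteConstantTwo.lean`) — exactly the printed `γ_D = max_Λ min_{x ∈ Λ∖0} (‖x‖/vol(Λ)^{1/D})²` [ArnaultEtAl2026,
Def. 3.3]. Abelian two-block codes: `AbelianTwoBlock.css a b` (`AbelianTwoBlockParameters.lean`: the CSS code
`H_X = [A|B]`, `H_Z = [Bᵀ|Aᵀ]`, `A = circulant a`, `B = circulant b` over a finite additive commutative group `G`,
with `CSSCode.k`, `CSSCode.dX`, `CSSCode.dZ` of `CSS.lean` and `css_dX_eq_dZ` proved) — the printed
«`H_X = [A|B]`, `H_Z = [Bᵀ|Aᵀ]`, `A = Σ a_g B(g)`, `B = Σ b_g B(g)`» [ArnaultEtAl2026, §2.2].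

Geometry [ArnaultEtAl2026, Thm. 3.6]: «the qubits are indexed by the vertices of `ℤ^D/Λ`, where `Λ` is a
`D`-dimensional sublattice of `ℤ^D` such that `|ℤ^D/Λ| = n`, and each vertex indexes `m` qubits» — we take
`Λ : AddSubgroup (Fin D → ℤ)` with `Λ.index = n` (finite index ⟺ full rank) and PLACE the `N` qubits by an explicit
bijection `e : Fin N ≃ (ℤ^D/Λ) × Fin m` (so `N = mn` automatically); «the support of any stabilizer is contained in a
Euclidean ball of `ℤ^D/Λ` of radius `ρ`» — `LatticeQuotient.InBall Λ ρ c q`: some representative of the vertex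
`q ∈ ℤ^D/Λ` lies within Euclidean distance `ρ` of the lattice point `c ∈ ℤ^D` (the CLOSED ball of the quotient metric
`dist([a],[b]) = inf_{g ∈ Λ} ‖a − b − g‖` of [ArnaultEtAl2026, Prop. 3.2]; closed as in §4 Lemma 4.4 «closed ball of
radius `1`»), `LatticeQuotient.IsBallLocal`, and `LatticeQuotient.HasBallLocalGenerators Λ e ρ S` = the stabilizer
space `S̄` is spanned by its `ρ`-local elements, i.e. «the support of any stabilizer GENERATOR is contained in a
Euclidean ball of radius `ρ`» (the reading of the restatement opening §3.4 and the one the proof and §4 use; the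
Theorem's own sentence says «any stabilizer»).

Contents: `LatticeQuotient.InBall`, `LatticeQuotient.IsBallLocal`, `LatticeQuotient.HasBallLocalGenerators`
(definitions); named facts `ArnaultEtAl2026_theorem36` (Thm. 3.6, general stabilizer codes on `ℤ^D/Λ`) and
`ArnaultEtAl2026_theorem41` (Thm. 4.1, abelian 2BGA codes). The CONDITIONAL corollary in explicit constants
(weight-6 abelian two-block codes, e.g. BB codes: `|G| ≥ 65536 ⟹ d ≤ 24 |G|^{3/4}`, from Thm. 4.1 and the tree's
PROVED `γ₄ ≤ 4`) is `AbelianTwoBlock.dX_le_of_ArnaultEtAl2026_theorem41` in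
`AbelianTwoBlockDistanceBoundWeightSix.lean` (it shows the typed hypothesis is dischargeable with tree constants and
is the form an «asymptotic» census sentence would cite).

Deliberately NOT here: the proof steps (Cleaning Lemma — in the tree as the slab machinery of
`LocalCodeDistanceBound.lean`, `sympDual_le_of_slabs`; Lemma 3.8 = Rankin duality `γ_{D,D−1} = γ_D` and Lemma 3.9,
no tree counterpart; Lemmas 3.10–3.13; §4 Lemmas 4.2–4.4, the embedding `Ψ : ℤ^{r+s} → G`); the Pryadko–Wang bicycle
bound with unspecified constants [ArnaultEtAl2026, §1.2]; non-abelian 2BGA codes (not covered in print).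
ℕ-subtraction avoided: `D = w − 2` is typed as `wt a + wt b = D + 2`.

References (read via `lit`, held text paper:arxiv-2502.04995, tex chunks; custody of locators qec-lit-4,
LIT-4-REGISTER §A4): F. Arnault, P. Gaborit, W. Rozendaal, N. Saussay, G. Zémor, *A Variant of the Bravyi–Terhal
Bound for Arbitrary Boundary Conditions*, IEEE Trans. Inform. Theory 72 (2026) 437–446 = arXiv:2502.04995
[ArnaultEtAl2026] (Def. 3.3 chunk p0006 L28–31; Thm. 3.6 chunk p0006 L58–68; §3.4 chunks p0007–p0009; Thm. 4.1
chunk p0010 L5–7; §1.3 chunk p0004 L1; proof of Thm. 4.1 chunk p0011 L60–61); J. J. Postema, S. J. J. M. F.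
Kokkelmans, *Existence and Characterisation of Bivariate Bicycle Codes*, IEEE Trans. Inform. Theory 72 (2026) =
arXiv:2502.17052 [PostemaKokkelmans2026] (Thm. 2.18 = [ArnaultEtAl2026, Thm. 4.1] quoted, chunk p0014 L2–8; «only
applies for `n ≥ 8192`», chunk p0014 L24–26).
-/

namespace Literature.InformationTheory.QuantumCodes

open Finset Literature.Algebra.EuclideanLattices

/-! ### Balls in the quotient `ℤ^D/Λ`; ball-local generators -/

namespace LatticeQuotient

variable {D N m : ℕ}

/-- **Closed Euclidean ball of `ℤ^D/Λ`.** The vertex `q ∈ ℤ^D/Λ` lies in the closed ball of radius `ρ` about (the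
class of) the lattice point `c ∈ ℤ^D`: some representative `x ∈ ℤ^D` of `q` has `Σᵢ (xᵢ − cᵢ)² ≤ ρ²`, i.e.
`dist([c],[q]) ≤ ρ` for the quotient distance `dist([a],[b]) = inf_{g ∈ Λ} ‖a − (b + g)‖` induced by the Euclidean
norm (the infimum is attained). Column: definition.
[cite: ArnaultEtAl2026, Prop. 3.2 (arXiv chunk p0006 L12–22) and Thm. 3.6 («Euclidean ball of ℤ^D/Λ of radius ρ», chunk p0006 L64)] -/
def InBall (Λ : AddSubgroup (Fin D → ℤ)) (ρ : ℝ) (c : Fin D → ℤ) (q : (Fin D → ℤ) ⧸ Λ) : Prop :=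
  ∃ x : Fin D → ℤ, (QuotientAddGroup.mk x : (Fin D → ℤ) ⧸ Λ) = q ∧ ∑ i, ((x i : ℝ) - c i) ^ 2 ≤ ρ ^ 2

/-- The Pauli class `v` on `N` qubits placed on `ℤ^D/Λ` (`m` per vertex) by `e` is **`ρ`-local**: all the vertices
carrying its support lie in one closed Euclidean ball of `ℤ^D/Λ` of radius `ρ` (centred at a vertex). Column:
definition.
[cite: ArnaultEtAl2026, Thm. 3.6, second hypothesis (arXiv chunk p0006 L64)] -/
def IsBallLocal (Λ : AddSubgroup (Fin D → ℤ)) (e : Fin N ≃ ((Fin D → ℤ) ⧸ Λ) × Fin m) (ρ : ℝ)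
    (v : SympVec N) : Prop :=
  ∃ c : Fin D → ℤ, ∀ i ∈ sympSupport v, InBall Λ ρ c (e i).1

/-- **`S̄` has `ρ`-local generators on `ℤ^D/Λ`**: the stabilizer space is spanned by its `ρ`-local elements, i.e.
`S = ⟨S_1,…,S_r⟩` for some (possibly over-complete) family of generators each supported in a closed Euclidean ball
of `ℤ^D/Λ` of radius `ρ` («there exists `ρ > 0` such that the support of any stabilizer generator is contained in a
Euclidean ball of `ℤ^D/Λ` of radius `ρ`»). Column: definition.
[cite: ArnaultEtAl2026, §3.4 first paragraph after Lemma 3.7 (arXiv chunk p0007 L7)] -/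
def HasBallLocalGenerators (Λ : AddSubgroup (Fin D → ℤ)) (e : Fin N ≃ ((Fin D → ℤ) ⧸ Λ) × Fin m) (ρ : ℝ)
    (S : Submodule (ZMod 2) (SympVec N)) : Prop :=
  S ≤ Submodule.span (ZMod 2) {v | v ∈ S ∧ IsBallLocal Λ e ρ v}

end LatticeQuotient

/-! ### Named facts -/

/-- **Arnault–Gaborit–Rozendaal–Saussay–Zémor 2026, Theorem 3.6** (the Bravyi–Terhal bound for arbitrary boundary
conditions). «Theorem 3.6. Let `𝒞` be stabilizer code of length `N = mn`. Suppose that the following conditions are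
satisfied: • The qubits are indexed by the vertices of `ℤ^D/Λ`, where `Λ` is a `D`-dimensional sublattice of `ℤ^D`
such that `|ℤ^D/Λ| = n`, and each vertex indexes `m` qubits. • The parity-checks are geometrically-local: there
exists `ρ > 0` such that the support of any stabilizer is contained in a Euclidean ball of `ℤ^D/Λ` of radius `ρ`.
• `n^{1/D} ≥ 8ρ√γ_D` where `γ_D` is the `D`-dimensional Hermite constant. Then the minimum distance of the
stabilizer code `𝒞` satisfies `d < m√γ_D(√D + 4ρ) n^{(D−1)/D}`.» Typed for qubits placed bijectively on
`(ℤ^D/Λ) × {1,…,m}` (`e`, so `N = mn`), `Λ` an additive subgroup of `ℤ^D` of index `n` (full rank ⟺ finite index;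
for infinite index `Λ.index = 0` and the hypotheses are unsatisfiable), locality of a GENERATING family (see the
module docstring), `γ_D = hermiteConstant D` of the tree, `D ≥ 1`, and `k ≥ 1` made explicit (the printed `d` is a
minimum over the non-trivial logical operators, which exist iff `k ≥ 1`; the proof «consider[s] a non-trivial logical
operator»); the conclusion bounds every `d` with «no logical of weight `< d`», i.e. the minimum distance. Column:
cited fact.

BARRIER
technique_class: geometric-locality, stabilizer-codes, euclidean-lattice, arbitrary-periodic-boundary, lattice-quotient, local-generators, hermite-constant, distance-vs-length
blocks: any family of stabilizer codes whose qubits sit `m` per vertex on quotients `ℤ^D/Λ` with generators of bounded Euclidean range `ρ` and whose distance grows faster than `n^{(D−1)/D}` (`n = |ℤ^D/Λ|`), once `n^{1/D} ≥ 8ρ√γ_D`: `d < m√γ_D(√D + 4ρ)n^{(D−1)/D}` — the Bravyi–Terhal exponent survives arbitrary («twisted») periodic boundary conditions at the price of the constant `√γ_D(√D + 4ρ)` in place of `ρ` [cite: ArnaultEtAl2026, Thm. 3.6 (arXiv chunk p0006 L58–68) and §1.3 («we therefore pay a minor penalty … growing at most linearly with the dimension D», chunk p0003)].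
because: choose a basis `u_1,…,u_D` of `Λ` minimising `vol(u_1,…,u_{D−1})`, so that by Rankin duality `γ_{D,D−1} = γ_D` the last Gram–Schmidt vector has `‖u*_D‖ ≥ n^{1/D}/√γ_D` (Lemmas 3.8–3.9); cut `ℝ^D/Λ` into an even number `μ` of parallel slabs of width `λ ∈ [2ρ, 4ρ)` along `u*_D` (Lemmas 3.12–3.13), so that no generator meets two non-adjacent slabs; the Cleaning Lemma applied to the odd slabs leaves a non-trivial logical operator inside one slab (Lemma 3.10), which holds at most `m·(n/‖u*_D‖)(λ + √D)` qubits by a unit-cube volume count (Lemma 3.11) [cite: ArnaultEtAl2026, §3.4 Lemmas 3.7–3.13 and proof of Thm. 3.6 (arXiv chunks p0007–p0009)].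
evasions_known: NON-local generators (general qLDPC / expander-based codes are outside the hypothesis); NON-abelian two-block codes are not shown to be lattice-quotient-local [cite: ArnaultEtAl2026, §2.2 last paragraph and §4 (abelian only)]; below the threshold `n^{1/D} < 8ρ√γ_D` nothing is claimed (for BB codes, `D = 4`, this is `n < 8192` [cite: PostemaKokkelmans2026, §2 after Thm. 2.19 (arXiv chunk p0014 L24–26)]); graph-embedded (non-lattice) connectivity is the Baspin–Krishna / Baspin–Guruswami–Krishna–Li setting «with loosely specified constants» [cite: ArnaultEtAl2026, §1.2 (arXiv chunk p0003)].
scope_caveats: the Theorem's sentence says «any stabilizer», the proof (§3.4, first paragraph; Lemmas 3.10, 3.12) and the application in §4 use «any stabilizer GENERATOR» — typed for generators (the only reading under which §4 applies it); `k ≥ 1` and `D ≥ 1` explicit; `γ_D` is the tree's supremum-defined Hermite constant (printed as a `max`); `N = mn` is carried by the bijection `e`; strict `<` as printed; qubits only.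
status: published theorem (IEEE Trans. Inform. Theory 2026); named fact (unproved in the tree; the slab/Cleaning-Lemma half is the tree's `sympDual_le_of_slabs` (`LocalCodeDistanceBound.lean`), the geometry-of-numbers half (Rankin duality, Gram–Schmidt, integral-point count) has no tree counterpart). [cite: ArnaultEtAl2026, Thm. 3.6 (arXiv:2502.04995 chunk p0006 L58–68)] -/
def ArnaultEtAl2026_theorem36 : Prop :=
  ∀ (D m n N k d : ℕ) (ρ : ℝ) (Λ : AddSubgroup (Fin D → ℤ)) (e : Fin N ≃ ((Fin D → ℤ) ⧸ Λ) × Fin m)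
    (S : Submodule (ZMod 2) (SympVec N)),
    1 ≤ D → 0 < ρ → Λ.index = n → LatticeQuotient.HasBallLocalGenerators Λ e ρ S →
      IsAdditiveCode S k d → 1 ≤ k →
      8 * ρ * Real.sqrt (hermiteConstant D) ≤ (n : ℝ) ^ (1 / (D : ℝ)) →
        (d : ℝ) < m * Real.sqrt (hermiteConstant D) * (Real.sqrt D + 4 * ρ) * (n : ℝ) ^ (((D : ℝ) - 1) / D)

/-- **Arnault–Gaborit–Rozendaal–Saussay–Zémor 2026, Theorem 4.1** (distance of abelian two-block group-algebra
codes). «Theorem 4.1. The minimum distance of a non-trivial Abelian 2BGA code of length `n` and stabilizer generators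
of weight `w`, is bounded from above by `2√γ_D(√D + 4)n^{(D−1)/D}` whenever `n^{1/D} ≥ 8√γ_D`, where `D = w − 2` and
`γ_D` is the Hermite constant.» Here (§2.2) an abelian 2BGA code on a finite abelian group `G` of order `n` is the
CSS code `H_X = [A|B]`, `H_Z = [Bᵀ|Aᵀ]`, `A = Σ_g a_g B(g)`, `B = Σ_g b_g B(g)`, «non-trivial whenever `A` or `B` is
non-zero. The code length is `N = 2n`», and `w = wt(a) + wt(b)` is the common weight of the rows of `H_X` and of
`H_Z`. READING OF `n`: the Theorem's «length `n`» is `n = |G|` (code length `2n`), as in the abstract and §1.3 («any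
Abelian 2BGA code with code length `2n` … bounded from above by `2√γ_D(√D + 4)n^{(D−1)/D}`») and in the proof
(«Let `𝒞` be a non-trivial Abelian 2BGA code of length `2n` … apply Theorem 3.6 with `m = 2` and `ρ = 1`») — typed
with `n = |G|`. Typed over the tree's `AbelianTwoBlock.css a b` (additive notation for `G`), `D ≥ 1` with
`wt a + wt b = D + 2` (no ℕ-subtraction), `γ_D = hermiteConstant D`, and `k ≥ 1` explicit (the printed minimum
distance is over non-trivial logical operators; in the tree's `ℕ`-valued `CSSCode.dX` the case `k = 0` would be the
junk value `0`); the conclusion is stated for `min(d_X, d_Z)` (`= d_X = d_Z`, `AbelianTwoBlock.css_dX_eq_dZ`), with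
«bounded from above by» read as `≤`. For BB codes (`w = 6`, `D = 4`) the hypothesis reads `|G| = ℓm ≥ 8⁴γ₄² = 8192`
(«Theorem 2.18 only applies for `n ≥ 8192`» [PostemaKokkelmans2026]); with the tree's PROVED `γ₄ ≤ 4` one gets the
unconditional-constant form `ℓm ≥ 65536 ⟹ d ≤ 24(ℓm)^{3/4}` (`AbelianTwoBlock.dX_le_of_ArnaultEtAl2026_theorem41`,
file `AbelianTwoBlockDistanceBoundWeightSix.lean`).
Numerically vacuous for every census object (`n ≤ 288`): an ASYMPTOTIC X1 entry. Column: cited fact.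

BARRIER
technique_class: geometric-locality, two-block-codes, abelian-group-algebra, generalized-bicycle, bivariate-bicycle, lattice-quotient, hermite-constant, distance-vs-length
blocks: every family of abelian two-block group-algebra codes (GB, BB, abelian 2BGA; the `1 × 1` lifted products) with check weight `w` and `d/|G|^{(w−3)/(w−2)} → ∞`: `d ≤ 2√γ_{w−2}(√(w−2) + 4)|G|^{(w−3)/(w−2)}` once `|G|^{1/(w−2)} ≥ 8√γ_{w−2}` — in particular weight-6 BB/abelian two-block codes have `d = O(n^{3/4})` and are asymptotically bad as LDPC families of fixed weight [cite: ArnaultEtAl2026, Thm. 4.1 (arXiv chunk p0010 L5–7) and §1.3 (chunk p0004 L1)] [cite: PostemaKokkelmans2026, Thm. 2.18–2.19 (arXiv chunk p0014 L2–17)].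
because: translate `a`, `b` so that `0 ∈ supp a ∩ supp b` (Lemma 4.2, a monomial equivalence); if the remaining support elements generate a proper subgroup `H` the code is `[G:H]` copies of the code on `H` (Lemma 4.3), else `Ψ : ℤ^{r+s} → G`, `εᵢ ↦` the `i`-th support element, `r + s = w − 2 = D`, identifies `G ≅ ℤ^D/ker Ψ` with every row of `H_X`, `H_Z` inside a closed ball of radius `1` (Lemma 4.4: the supports are `Ψ̄⁻¹(g) ∓ εᵢ`); apply Thm. 3.6 with `m = 2`, `ρ = 1` [cite: ArnaultEtAl2026, §4 Lemmas 4.2–4.4 and proof of Thm. 4.1 (arXiv chunks p0010–p0011)].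
evasions_known: NON-abelian two-block group-algebra codes (`rank H_X ≠ rank H_Z` possible; no lattice-quotient embedding given) — «the open question whether non-abelian group algebras may generate codes … that produce asymptotically good parameters» [cite: PostemaKokkelmans2026, §2 after Thm. 2.19 (arXiv chunk p0014 L20–23)]; growing check weight `w` (the exponent `(w−3)/(w−2) → 1`); general lifted/hypergraph/balanced products with larger base matrices are outside the hypothesis [cite: ArnaultEtAl2026, §2.2 last sentence (abelian 2BGA = lifted product with 1 × 1 matrices)].
scope_caveats: threshold `|G| ≥ 8^D γ_D^{D/2}` (BB: `8192`; the tree proves only `γ_D ≤ D`, under which `|G| ≥ (8√D)^D` suffices); «length n» in the Theorem's sentence vs `2n` in abstract/§1.3/proof — typed with `n = |G|` (our reading, the one proved); the reduction of Lemma 4.3 to an indecomposable sub-code on `H ≤ G` applies Thm. 3.6 to `|H|`, whose size is not shown to meet the threshold when `|G|` does (printed: «if the bound of Theorem 4.1 holds for a subcode 𝒞̃, then it also holds for the code 𝒞») — typed AS PRINTED for all non-trivial codes (our remark, qec-type-06 g4); Lemma 4.2 picks `g_a ∈ supp a`, `g_b ∈ supp b` (both blocks non-zero) while «non-trivial» is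 «A or B non-zero» — typed as printed (`a ≠ 0 ∨ b ≠ 0`; with one block zero and `k ≥ 1` the distance is `1`, our remark); the printed proof opens with «weight `w ≥ 4`», the Theorem has no such restriction — typed for `D ≥ 1` (`w ≥ 3`); `k ≥ 1` explicit; `≤` for «bounded from above by».
status: published theorem (IEEE Trans. Inform. Theory 2026); named fact (unproved in the tree; needs `ArnaultEtAl2026_theorem36` plus §4's embedding, the latter being finite group theory available over Mathlib). [cite: ArnaultEtAl2026, Thm. 4.1 (arXiv:2502.04995 chunk p0010 L5–7), §1.3 (chunk p0004 L1), proof (chunk p0011 L60–61)] -/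
def ArnaultEtAl2026_theorem41 : Prop :=
  ∀ (G : Type) [Fintype G] [AddCommGroup G] (a b : G → ZMod 2) (D : ℕ),
    (a ≠ 0 ∨ b ≠ 0) → 1 ≤ D → hammingNorm a + hammingNorm b = D + 2 → 0 < (AbelianTwoBlock.css a b).k →
      8 * Real.sqrt (hermiteConstant D) ≤ (Fintype.card G : ℝ) ^ (1 / (D : ℝ)) →
        ((min (AbelianTwoBlock.css a b).dX (AbelianTwoBlock.css a b).dZ : ℕ) : ℝ) ≤
          2 * Real.sqrt (hermiteConstant D) * (Real.sqrt D + 4) * (Fintype.card G : ℝ) ^ (((D : ℝ) - 1) / D)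

end Literature.InformationTheory.QuantumCodes
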